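import Mathlib

/-!
# Stub `stub_cliqueCount` of line `Sketch` (crux `RamseyNotNP`, stmt-PneNP-9814)

For a FIXED vertex set `S ⊆ Fin n`, at most a `2^{-C(k,2)}` fraction of all labelled graphs on
`Fin n` have `S` as a `k`-clique, in multiplication form (no division, no closed form for the
number of graphs needed):

`#{G : SimpleGraph (Fin n) | G.IsNClique k S} · 2^{C(k,2)} ≤ #(SimpleGraph (Fin n))`.

This is the per-candidate-set count in the union bound behind Erdős's 1947 probabilistic lower
bound `R(k,k) > 2^{k/2}` (union bound, Erdős 1947 / folklore); the lead's skeleton of line `Sketch`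
glues it with an arithmetic stub into `RamseyDense` ("almost every graph on `Fin n` is 2-Ramsey").

Proof (product injection). Let `T := S.offDiag.image Sym2.mk.uncurry` be the pairs inside `S`;
`#T = C(#S, 2)` (`Sym2.card_image_offDiag`). If `S` is a clique of `G`, every pair of `T` is an edge
of `G` (`mem_edgeSet_of_mem_pairs`), so for `F ⊆ T` the graph `G.deleteEdges F` determines both
`F` (the pairs of `T` it misses, `filter_not_mem_edgeSet_eq`) and `G` (restore all pairs
of `T`, `deleteEdges_sup_fromEdgeSet_eq`). Hence `(G, F) ↦ G.deleteEdges F` is injective on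
`{G | G.IsNClique k S} ×ˢ 𝒫(T)`, a finset of cardinality `#filter · 2^{C(k,2)}`, and lands in
`univ`. If `#S ≠ k` the filter is empty (`SimpleGraph.IsNClique.card_eq`).

Design: pure Mathlib vocabulary, no definitions; stated under `open scoped Classical` exactly as the
registered stub (the `DecidablePred` of the filter is the classical one of the skeleton).
-/

set_option linter.dupNamespace false

namespace Summit.PneNP.PneNP.Theorems.RamseyNotNP.TypicalCapture

open Finset

noncomputable section
open scoped Classical

/-- Every pair inside a clique `S` of `G` is an edge of `G`: if `e = s(v, w)` with `v ≠ w` both in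
`S` and `S` is a clique of `G`, then `e ∈ G.edgeSet`. [folklore] -/
theorem mem_edgeSet_of_mem_pairs {n : ℕ} {S : Finset (Fin n)} {G : SimpleGraph (Fin n)}
    (hG : G.IsClique S) {e : Sym2 (Fin n)} (he : e ∈ S.offDiag.image Sym2.mk.uncurry) :
    e ∈ G.edgeSet := by
  obtain ⟨⟨v, w⟩, hvw, rfl⟩ := mem_image.mp he
  obtain ⟨hv, hw, hne⟩ := mem_offDiag.mp hvw
  exact (SimpleGraph.mem_edgeSet G).mpr (hG hv hw hne)

/-- Restoring all pairs of a clique `S` of `G` undoes the deletion of some of them: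
`G.deleteEdges F ⊔ fromEdgeSet T = G` for `F ⊆ T = pairs of S`. [folklore] -/
theorem deleteEdges_sup_fromEdgeSet_eq {n : ℕ} {S : Finset (Fin n)} {G : SimpleGraph (Fin n)}
    (hG : G.IsClique S) {F : Finset (Sym2 (Fin n))}
    (hF : F ⊆ S.offDiag.image Sym2.mk.uncurry) :
    G.deleteEdges (F : Set (Sym2 (Fin n))) ⊔
        SimpleGraph.fromEdgeSet (↑(S.offDiag.image Sym2.mk.uncurry) : Set (Sym2 (Fin n))) = G := by
  ext a b
  simp only [SimpleGraph.sup_adj, SimpleGraph.deleteEdges_adj, SimpleGraph.fromEdgeSet_adj,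
    Finset.mem_coe]
  constructor
  · rintro (⟨h, -⟩ | ⟨h, -⟩)
    · exact h
    · exact (SimpleGraph.mem_edgeSet G).mp (mem_edgeSet_of_mem_pairs hG h)
  · intro h
    by_cases hab : s(a, b) ∈ F
    · exact Or.inr ⟨hF hab, h.ne⟩
    · exact Or.inl ⟨h, hab⟩

/-- The deleted pairs are recovered as the pairs of the clique `S` missing from the result:
`{e ∈ T | e ∉ E(H)} = F` when `H = G.deleteEdges F` and `F ⊆ T = pairs of S` (stated for a named
result `H`, so that the `DecidablePred` of the filter does not mention `G` or `F`). [folklore] -/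
theorem filter_not_mem_edgeSet_eq {n : ℕ} {S : Finset (Fin n)}
    {G H : SimpleGraph (Fin n)} (hG : G.IsClique S) {F : Finset (Sym2 (Fin n))}
    (hF : F ⊆ S.offDiag.image Sym2.mk.uncurry) (hH : G.deleteEdges (F : Set (Sym2 (Fin n))) = H) :
    ((S.offDiag.image Sym2.mk.uncurry).filter fun e => e ∉ H.edgeSet) = F := by
  subst hH
  ext e
  simp only [mem_filter, SimpleGraph.edgeSet_deleteEdges, Set.mem_sdiff, Finset.mem_coe, not_and,
    not_not]
  constructor
  · rintro ⟨he, h⟩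
    exact h (mem_edgeSet_of_mem_pairs hG he)
  · intro he
    exact ⟨hF he, fun _ => he⟩

/-- The count for a vertex set of the right size: if `#S = k` then
`#{G | G.IsNClique k S} · 2^{C(k,2)} ≤ #(SimpleGraph (Fin n))`, by the injection
`(G, F) ↦ G.deleteEdges F` on `{G | G.IsNClique k S} ×ˢ 𝒫(pairs of S)`. [folklore] -/
theorem card_filter_isNClique_mul_le {n k : ℕ} (S : Finset (Fin n)) (hSk : S.card = k) :
    (univ.filter fun G : SimpleGraph (Fin n) => G.IsNClique k S).card * 2 ^ k.choose 2 ≤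
      Fintype.card (SimpleGraph (Fin n)) := by
  set T : Finset (Sym2 (Fin n)) := S.offDiag.image Sym2.mk.uncurry with hT
  have hTcard : T.card = k.choose 2 := by
    rw [hT, Sym2.card_image_offDiag, hSk]
  have hdom : ((univ.filter fun G : SimpleGraph (Fin n) => G.IsNClique k S) ×ˢ T.powerset).card =
      (univ.filter fun G : SimpleGraph (Fin n) => G.IsNClique k S).card * 2 ^ k.choose 2 := by
    rw [card_product, card_powerset, hTcard]
  rw [← hdom, ← card_univ]
  refine card_le_card_of_injOn (fun p => p.1.deleteEdges (p.2 : Set (Sym2 (Fin n))))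
    (fun p _ => Finset.mem_coe.mpr (mem_univ _)) ?_
  rintro ⟨G₁, F₁⟩ h₁ ⟨G₂, F₂⟩ h₂ h
  simp only [Finset.mem_coe, mem_product, mem_filter, mem_univ, true_and, mem_powerset] at h₁ h₂
  simp only at h
  obtain ⟨hG₁, hF₁⟩ := h₁
  obtain ⟨hG₂, hF₂⟩ := h₂
  have hF : F₁ = F₂ :=
    (filter_not_mem_edgeSet_eq hG₁.isClique hF₁ h).symm.trans
      (filter_not_mem_edgeSet_eq hG₂.isClique hF₂ rfl)
  have hG : G₁ = G₂ := by
    rw [← deleteEdges_sup_fromEdgeSet_eq hG₁.isClique hF₁,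
      ← deleteEdges_sup_fromEdgeSet_eq hG₂.isClique hF₂, h]
  exact Prod.ext hG hF

/-- **Stub A of line `Sketch` — clique count (union bound, Erdős 1947 / folklore).** For every
vertex set `S ⊆ Fin n`, the number of graphs on `Fin n` in which `S` is a `k`-clique, times
`2^{C(k,2)}`, is at most the number of all graphs on `Fin n`; if `#S ≠ k` the filter is empty.
[folklore] -/
theorem stub_cliqueCount :
    ∀ (n k : ℕ) (S : Finset (Fin n)),
      (univ.filter fun G : SimpleGraph (Fin n) => G.IsNClique k S).card * 2 ^ k.choose 2 ≤
        Fintype.card (SimpleGraph (Fin n)) := by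
  intro n k S
  by_cases hSk : S.card = k
  · exact card_filter_isNClique_mul_le S hSk
  · have hempty : (univ.filter fun G : SimpleGraph (Fin n) => G.IsNClique k S) = ∅ :=
      filter_eq_empty_iff.mpr fun G _ hG => hSk hG.card_eq
    rw [hempty, card_empty, zero_mul]
    exact Nat.zero_le _

end

end Summit.PneNP.PneNP.Theorems.RamseyNotNP.TypicalCapture
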